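import Literature.AlgebraicGeometry.AbelianSchemes.AbelianSchemeSymplecticLevel
import Literature.AlgebraicGeometry.AbelianSchemes.AbelianSchemeQuotientMulNDescent
import Literature.AlgebraicGeometry.AbelianVarieties.AbelianVarietyWeilDivisorBundleDictionary
import Literature.AlgebraicGeometry.Motives.AbelianVarietyWeilPairingDiscrepancy
import HarnessLib

/-!
# On a geometric fibre, the Weil pairing of the polarisation is the inverse discrepancy of a trivialisation of
# `[n]^* (𝒫|_{A_s̄ × {λ̄(Q)}})` at the translation `t_P` (Mumford §20: `ē^L(x, y) = e_n(x, φ_L(y))`)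

Layer `Literature/AlgebraicGeometry/AbelianSchemes`, namespace `Literature.AlgebraicGeometry.AbelianSchemes.AbelianSchemeOver`.
THEOREMS ONLY (no definition, no named fact, no instance, no notation, no `sorry`).

For an abelian scheme `A/S` with dual pair `D` (Poincaré sheaf `𝒫` on `A ×_S Â`), a homomorphism `λ : A → Â`, a
geometric point `s : Spec Ω → S` and a witness divisor `Θ` on the fibre `A_s` with `IsLambdaOfAt s D λ Θ` (★
`AbelianSchemePolarization`: `𝒫|_{A_s × {λ̄(Q)}} ≅ t_Q^*𝒪(Θ) ⊗ 𝒪(Θ)⁻¹` for all `Q`), the level-`n` Weil pairing of the tree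
(★ `AbelianVariety.weilPairingLevel Θ P Q`, Lang VII §2 / Milne §16) is computed by ANY trivialisation
`e : [n]^* L_Q ≅ [n]^* 𝒪`, `L_Q := 𝒫|_{A_s × {λ̄(Q)}} = D.pullbackP s λ̄(Q)`, and ANY action over `[n]_{A_s}` whose element `g` acts by
`t_P`: if the discrepancy of `e` at `g` (★ `RelativeSpec/PullbackIsoDiscrepancy`) is the constant `u ∈ Γ(Spec Ω, 𝒪) = Ω`
(the shape delivered by ★ `TorsionSectionPairing.exists_poincarePairingUnit_fun`), then
**`ē_n^Θ(P, Q) = u⁻¹`** (`weilPairingLevel_eq_inv_of_poincare_discrepancy`).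

Proof: the dictionary `[t_Q^*𝒪(Θ) ⊗ 𝒪(Θ)⁻¹] = [𝒪(D_Q)]` (★ `detClass_translateTensorDual_eq_cechClass_weilDiv`, rank-one
modules with equal classes are isomorphic, ★ `nonempty_iso_iff_detClass_eq`) gives `j : 𝒪(D_Q) ≅ L_Q`
(`nonempty_lineBundle_weilDiv_iso_pullbackP`); conjugating `e` by `[n]^* j` does not change discrepancies (★
`discrepancy_conj`); `[n]_{A_s}` of the base-changed abelian scheme IS `[n]` of the fibre abelian variety
(`mulN_baseChange_left_eq_toSchemeHom`); conclude by ★ `AbelianVariety.weilPairingLevel_eq_inv_of_discrepancy`.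
This is [MumfordAV1970] §20 p. 184 / §23 «`ē^L(x, y) = e_n(x, φ_L(y))`» combined with Milne §16 p. 132 «it is shown in
[Mumford §20 p. 184] that `ē_m(a, a′) = g / g ∘ t_a`», at a geometric fibre of an abelian scheme.

Cell `hodgecm-mathlib` (D-0151), F-DAG hand (h9-S) piece (W3a) (the fibre evaluation of the rigid relative character pairing;
sequel (W3-core) evaluates the ★ (W1b) unit over a connected base at two geometric points via ★ (W1c)
`pairingUnit_baseChange` and transports with ★ `RootsOfUnityEvaluationTransport` / `SimilitudeTransport`).  Count-neutral;
HC_CM is proved only modulo the 7 printed citations until rung 0 closes — nothing here is about HC.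

## References
* [MumfordAV1970] D. Mumford, *Abelian Varieties* (1970), §20 (p. 184), §23 (p. 228).
* [MumfordFogartyKirwan1994] D. Mumford, J. Fogarty, F. Kirwan, *GIT*, 3rd ed., Ch. 6 §2 Def. 6.2 (p. 120).
* [Milne1986AbelianVarieties] J. S. Milne, *Abelian Varieties* (1986), §16 (p. 132).
* [Hartshorne1977] R. Hartshorne, *Algebraic Geometry*, III Ex. 4.5.
-/

set_option autoImplicit false

noncomputable section

-- `TopCat.Presheaf`/`Scheme.Modules` are not reducible (as in Mathlib's `AlgebraicGeometry/Modules`).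
set_option backward.isDefEq.respectTransparency false

universe u

open CategoryTheory Limits AlgebraicGeometry TopologicalSpace Opposite MonoidalCategory
open Literature.AlgebraicGeometry.Modules Literature.AlgebraicGeometry.Motives Literature.AlgebraicGeometry.RelativeSpec
open Literature.AlgebraicGeometry.RelativeSpec.ActionOver Literature.AlgebraicGeometry.AbelianVarieties

namespace Literature.AlgebraicGeometry.AbelianSchemes.AbelianSchemeOver

open scoped MonObj

variable {S : Scheme.{u}} (A : AbelianSchemeOver S) (D : A.DualPair) (lam : A.X ⟶ D.hat.X)
  {Ω : Type u} [Field Ω] (s : Spec (.of Ω) ⟶ S)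

/-! ## §1 `[n]` of the base change to a point is `[n]` of the fibre abelian variety -/

/-- **`([n]_{A_s})` of the abelian scheme `A ×_S Spec Ω` is the scheme morphism `[n]` of the fibre abelian variety `A_s`**
(same group object: ★ `AbelianVariety.hom_zsmul_id`, `zpow_natCast`, ★ `mulN_def`). [cite: MumfordAV1970, §20 (p. 184)] -/
theorem mulN_baseChange_left_eq_toSchemeHom (n : ℕ) :
    ((A.baseChange s).mulN n).left = AbelianVariety.Hom.toSchemeHom ((n : ℤ) • 𝟙 (A.fibre s).toAbelianVariety) := by
  change _ = ((((n : ℤ) • 𝟙 (A.fibre s).toAbelianVariety).hom.hom.hom)).left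
  rw [AbelianVariety.hom_zsmul_id, zpow_natCast]
  rfl

/-! ## §2 The dictionary `𝒪(D_Q) ≅ 𝒫|_{A_s × {λ̄(Q)}}` -/

/-- **`𝒪_{A_s}(D_Q^Θ) ≅ 𝒫|_{A_s × {λ̄(Q)}}`** for a witness `Θ` of `λ` at `s` (`IsLambdaOfAt`): the slice is
`t_Q^*𝒪(Θ) ⊗ 𝒪(Θ)⁻¹` ([MumfordFogartyKirwan1994] Def. 6.2 «`Λ(L)(x) = T_x^*L ⊗ L⁻¹`»), whose class in `Ȟ¹(A_s, 𝒪^×)` is that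
of the Weil divisor `D_Q = t_Q^*Θ − Θ` (★ `detClass_translateTensorDual_eq_cechClass_weilDiv`), and rank-one modules with the
same class are isomorphic (★ `nonempty_iso_iff_detClass_eq`, Hartshorne III Ex. 4.5).
[cite: MumfordFogartyKirwan1994, Ch. 6 §2 Definition 6.2 (p. 120)] [cite: Hartshorne1977, III Ex. 4.5] -/
theorem nonempty_lineBundle_weilDiv_iso_pullbackP {Θ : CartierDivisor (A.fibre s).toAbelianVariety.X.left}
    (hΘ : A.IsLambdaOfAt s D lam Θ) (Q : (A.fibre s).toAbelianVariety.Points Ω) :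
    Nonempty (Modules.lineBundle ((A.fibre s).toAbelianVariety.weilDiv Θ Q).toUnitCocycle ≅
      D.pullbackP s (A.valueAt s D lam Q) (A.valueAt_comp_hom s D lam Q)) := by
  obtain ⟨i⟩ := hΘ Q
  -- `t_Q^*𝒪(Θ) ⊗ 𝒪(Θ)⁻¹ ≅ 𝒪(D_Q)` by comparing determinant classes
  have hrk : HasRank (tensorObj ((Scheme.Modules.pullback ((A.fibre s).toAbelianVariety.translation Q).left).obj
      (Modules.lineBundle Θ.toUnitCocycle)) (Modules.dual (Modules.lineBundle Θ.toUnitCocycle))) 1 :=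
    hasRank_tensorObj_one (hasRank_pullback _ Θ.toUnitCocycle.hasRank_lineBundle)
      (hasRank_dual Θ.toUnitCocycle.hasRank_lineBundle)
  obtain ⟨k⟩ := (nonempty_iso_iff_detClass_eq hrk ((A.fibre s).toAbelianVariety.weilDiv Θ Q).toUnitCocycle.hasRank_lineBundle
    (HasRank.isFiniteLocallyFree' hrk)
    ((A.fibre s).toAbelianVariety.weilDiv Θ Q).toUnitCocycle.isFiniteLocallyFree_lineBundle).2
    (by rw [detClass_translateTensorDual_eq_cechClass_weilDiv, detClass_lineBundle_toUnitCocycle])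
  exact ⟨k.symm ≪≫ i.symm⟩

/-! ## §3 The Weil pairing is the inverse discrepancy -/

/-- **`ē_n^Θ(P, Q) = u⁻¹` ON A GEOMETRIC FIBRE.**  Let `Θ` witness `λ` at `s` (`IsLambdaOfAt`), `P, Q ∈ A_s[n](Ω)` with `n`
invertible in `Ω`, `ρ` an action of a group `K` on `A_s = A ×_S Spec Ω` over `[n]_{A_s}` with `σ_g = t_P`, and
`e : [n]^* L_Q ≅ [n]^* 𝒪` (`L_Q = D.pullbackP s λ̄(Q) = 𝒫|_{A_s × {λ̄(Q)}}`) with discrepancy at `g` the constant global function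
`[n]^♯ π^♯ u`, `u ∈ Γ(Spec Ω, 𝒪)`.  Then `weilPairingLevel Θ P Q = (ΓSpecIso u)⁻¹` — Mumford's `e_n(P, λ̄(Q))` (§20 p. 184,
the scalar by which `t_P` acts on a trivialisation of `n^* L_Q`) against the tree's Lang/Milne pairing `g / g ∘ t_a`.
[cite: MumfordAV1970, §20 (p. 184) and §23 (p. 228)] [cite: Milne1986AbelianVarieties, §16 (p. 132)] -/
theorem weilPairingLevel_eq_inv_of_poincare_discrepancy {Θ : CartierDivisor (A.fibre s).toAbelianVariety.X.left}
    (hΘ : A.IsLambdaOfAt s D lam Θ) {n : ℕ} (hn : (n : Ω) ≠ 0)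
    (P Q : (A.fibre s).toAbelianVariety.torsionPoints Ω n)
    {K : Type u} [Group K] (ρ : ActionOver ((A.baseChange s).mulN n).left K) (g : K)
    (hg : ρ.autHom g = ((A.fibre s).toAbelianVariety.translation P.1).left)
    (e : (Scheme.Modules.pullback ((A.baseChange s).mulN n).left).obj
        (D.pullbackP s (A.valueAt s D lam Q.1) (A.valueAt_comp_hom s D lam Q.1)) ≅
      (Scheme.Modules.pullback ((A.baseChange s).mulN n).left).obj
        (SheafOfModules.unit (A.baseChange s).X.left.ringCatSheaf))
    (u : Γ(Spec (.of Ω), ⊤))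
    (he : (Scheme.Modules.pullback (ρ.autHom g)).map e.hom ≫
        ((EquivariantStructure.ofPullback ρ (SheafOfModules.unit (A.baseChange s).X.left.ringCatSheaf)).iso g).hom =
      ((EquivariantStructure.ofPullback ρ
          (D.pullbackP s (A.valueAt s D lam Q.1) (A.valueAt_comp_hom s D lam Q.1))).iso g).hom ≫ e.hom ≫
        globalScalar _ (((A.baseChange s).mulN n).left.appTop ((A.baseChange s).X.hom.appTop u))) :
    haveI := AbelianVariety.isDominant_toSchemeHom_zsmul_of_ne_zero (A.fibre s).toAbelianVariety hn
    (A.fibre s).toAbelianVariety.weilPairingLevel Θ P Q = ((Scheme.ΓSpecIso (.of Ω)).hom u)⁻¹ := by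
  haveI := AbelianVariety.isDominant_toSchemeHom_zsmul_of_ne_zero (A.fibre s).toAbelianVariety hn
  obtain ⟨j⟩ := A.nonempty_lineBundle_weilDiv_iso_pullbackP D lam s hΘ Q.1
  -- conjugate `e` by `[n]^* j`: same discrepancy
  have he' := discrepancy_conj ρ _ _ e (Iso.refl _) j _ g he
  haveI : IsDominant ((A.baseChange s).mulN n).left := by
    rw [A.mulN_baseChange_left_eq_toSchemeHom s n]; infer_instance
  exact (A.fibre s).toAbelianVariety.weilPairingLevel_eq_inv_of_discrepancy (A.mulN_baseChange_left_eq_toSchemeHom s n)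
    ρ g Θ P Q hg _ _ ((Scheme.ΓSpecIso (.of Ω)).hom u)
    ((A.fibre s).toAbelianVariety.ofSection_appTop_appTop (m := ((A.baseChange s).mulN n).left)
      (Over.w ((A.baseChange s).mulN n)) u) he'

end Literature.AlgebraicGeometry.AbelianSchemes.AbelianSchemeOver

end
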